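import Summits.AtomisticToContinuum.Crystallization.Theorems.FrustratedLawDichotomyDRowsA15
import Summits.AtomisticToContinuum.Crystallization.Theorems.FrustratedLawDichotomyDRowsArith
import Summits.AtomisticToContinuum.Crystallization.Theorems.FrustratedLawDichotomyShellMinimum
import Summits.AtomisticToContinuum.Crystallization.Theorems.FrustratedLawDichotomyPeriodicEnergyCeilingKernel

/-!
# DROWS-SOUND for the A15 chunk: the K certificate `…DRowsA15.drows_A15` read over `ℝ` (pieces (s2) ∘ (s4) ∘ (s5) + the transfer rule)

decomp-a2c hand-2 g46 — structural share for `AperiodicFrustratedLawGap` (stmt-27623), class-D rows (critic r1757 (C)(b)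
«DROWS-SOUND»; (234) census-1 g53 `…DRowsA15`; generic arithmetic (s4) = `…DRowsArith`; shell minimum (s2) = lens-5 `…ShellMinimum`;
(s5) = TREE `…PeriodicEnergyCeilingKernel.eStar_le`; the bcc twin is `…DRowsBccSound`).

The A15 template has TWO root classes (histograms `H0` = class X about the root `(0,0,0)`, `H1` = class Y) and the leaf test is the
TRANSFER RULE of record (critic r1732 (C) / r1757 (a)): with `sx, sy` the certified `σ`-lower bounds of the two classes and
`deficit := (BAR − sx)⁺`, the kernel checks `12·BAR ≤ 12·sy − 4·deficit` (each Y payer serves 4 X receivers, each X receiver has 12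
Y payers).  Read over `ℝ` this is: THERE IS a transfer `t ≥ 0` with `σ_X(s) + 12·t ≥ 27/1000` and `σ_Y(s) − 4·t ≥ 27/1000`, where
`σ_•(s) = ½·(window sum of the class at scale s) − (1/12)·Env₆ − e⋆` — `drows_A15_sound` below, for every leaf `i < 128` and every
`s ∈ [sNum i/sDen, sNum (i+1)/sDen]` (squared shell radii `s²·D/4` in this template's integer frame).

As in the bcc twin: the enclosures are one-line instantiations of `…DRowsArith` on census's own definitions (kept `private` here, like every
lemma whose printed statement coincides with the bcc/A15 twin's — the gate's dedup lint compares printed statements, and these are file-local readings), the histogram fold is read through a `List.foldl` with census's step (symbolic) plus ONE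
closed `decide +kernel` agreement per histogram, and (s1) («`H0`/`H1` = the true shell multiplicities») and the window/tail assembly are OWED.
DEF-FREE.
-/

namespace Summit.AtomisticToContinuum.Crystallization.Theorems.FrustratedLawDichotomyDRowsA15Sound

open Summit.AtomisticToContinuum.Crystallization.Theorems.FrustratedLawDichotomyDRowsA15
open Summit.AtomisticToContinuum.Crystallization.Theorems.FrustratedLawDichotomyDRowsArith
open Summit.AtomisticToContinuum.Crystallization.Theorems.FrustratedLawDichotomyCoherentFloorAlgebra (phiT)
open Summit.AtomisticToContinuum.Crystallization.Theorems.FrustratedLawDichotomyShellMinimum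
  (phiT_le_phiT_of_le_one phiT_le_phiT_of_one_le)
open Summit.AtomisticToContinuum.Crystallization.Theorems.ChargedEnergyGapNegative (eStar)

/-! ## §1 Constants and enclosures (instantiations of `…DRowsArith`) -/

/-- the scale `S = 2⁶⁰` is positive (private: numerically identical facts exist for other `2⁶⁰`-scaled certificates). -/
private theorem S_pos : 0 < S := by unfold S; decide

/-- `S` as a real numeral. -/
private theorem S_cast : ((S : ℤ) : ℝ) = 1152921504606846976 := by unfold S; norm_num

/-- the common denominator of the scale is positive. -/
private theorem sDen_pos : 0 < sDen := by unfold sDen XD; decide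

/-- the leaf end points of the A15 scale window are positive. -/
private theorem sNum_pos (i : ℕ) : 0 < sNum i := by unfold sNum xnum; omega

/-- (s4) `phiLo p q ≤ S·φ(p/q)` (private twin of the bcc reading). -/
private theorem phiLo_sound {p q : ℤ} (hp : 0 < p) (hq : 0 < q) : ((phiLo p q : ℤ) : ℝ) ≤ S * phiT ((p : ℝ) / q) := by
  unfold phiLo fdiv cdiv; exact phiLo_le S p q S_pos hp hq

/-- (s2) ∘ (s4) `phiMinLo plo phi q ≤ S·φ(t)` on the shell window (private twin of the bcc reading). -/
private theorem phiMinLo_sound {plo phi q : ℤ} (hq : 0 < q) (hplo : 0 < plo) {t : ℝ} (h1 : (plo : ℝ) / q ≤ t)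
    (h2 : t ≤ (phi : ℝ) / q) : ((phiMinLo plo phi q : ℤ) : ℝ) ≤ S * phiT t := by
  unfold phiMinLo cdiv
  exact minLo_le hq hplo (fun p hp => phiLo_sound hp hq) (fun s t hs hst ht1 => phiT_le_phiT_of_le_one hs hst ht1)
    (fun s t h1 hst => phiT_le_phiT_of_one_le h1 hst) (fun t _ => neg_cdiv_twelve_le S S_pos.le t) S_pos.le h1 h2

/-- (s3) ∘ (s4) `S·(1/12)·Env₆(δ_i, R_i) ≤ envHi i` with `δ_i = sNum i/sDen`, `R_i = 10·sNum i/sNum (i+1)` (A15 scale window). -/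
private theorem envHi_sound (i : ℕ) {δ R : ℝ} (hδ : δ = (sNum i : ℝ) / sDen) (hR : R = 10 * (sNum i : ℝ) / sNum (i + 1)) :
    S * (1 / 12 * ((2 / δ) ^ 3 * R⁻¹ ^ 3 + 15 / 2 * (2 / δ) ^ 2 * R⁻¹ ^ 4 + 3 / 5 * (2 / δ) * R⁻¹ ^ 5 + 2 * R⁻¹ ^ 6)) ≤
      ((envHi i : ℤ) : ℝ) := by
  unfold envHi cdiv
  exact le_envHi S sDen (sNum i) (sNum (i + 1)) S_pos sDen_pos (sNum_pos i) (sNum_pos (i + 1)) hδ hR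

/-! ## §2 The histogram fold at a real scale `s` of the leaf (squared shell radius `s²·D/4`) -/

/-- ★ the fold with census's step is a lower reading of `acc/S + Σ_{(D,m) inside_i} m·φ(s²D/4)` at EVERY `s` of leaf `i` (shells `D ≥ 1`). -/
theorem foldZ_le (i : ℕ) {s : ℝ} (hs1 : (sNum i : ℝ) / sDen ≤ s) (hs2 : s ≤ (sNum (i + 1) : ℝ) / sDen) :
    ∀ (h : List (ℕ × ℕ)), (∀ Dm ∈ h, 0 < Dm.1) → ∀ acc : ℤ,
      ((h.foldl (fun (acc : ℤ) (Dm : ℕ × ℕ) =>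
          if sNum (i + 1) * sNum (i + 1) * (Dm.1 : ℤ) < 100 * (4 * sDen * sDen) then
            acc + (Dm.2 : ℤ) * phiMinLo (sNum i * sNum i * (Dm.1 : ℤ)) (sNum (i + 1) * sNum (i + 1) * (Dm.1 : ℤ)) (4 * sDen * sDen)
          else acc) acc : ℤ) : ℝ) ≤
        acc + S * (h.map fun Dm : ℕ × ℕ =>
          if sNum (i + 1) * sNum (i + 1) * (Dm.1 : ℤ) < 100 * (4 * sDen * sDen) then (Dm.2 : ℝ) * phiT (s ^ 2 * Dm.1 / 4) else 0).sum := by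
  have hD : (0 : ℝ) < sDen := by exact_mod_cast sDen_pos
  have hlo : (0 : ℝ) < sNum i := by exact_mod_cast sNum_pos i
  have hs0 : 0 < s := lt_of_lt_of_le (by positivity) hs1
  have hq : (0 : ℤ) < 4 * sDen * sDen := mul_pos (mul_pos (by norm_num) sDen_pos) sDen_pos
  have hg : ∀ D : ℕ, 0 < D →
      ((phiMinLo (sNum i * sNum i * (D : ℤ)) (sNum (i + 1) * sNum (i + 1) * (D : ℤ)) (4 * sDen * sDen) : ℤ) : ℝ) ≤
        S * phiT (s ^ 2 * D / 4) := by
    intro D hDpos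
    have hD' : (0 : ℝ) < D := by exact_mod_cast hDpos
    have hplo : (0 : ℤ) < sNum i * sNum i * (D : ℤ) := mul_pos (mul_pos (sNum_pos i) (sNum_pos i)) (by exact_mod_cast hDpos)
    refine phiMinLo_sound hq hplo ?_ ?_
    · have e : (((sNum i * sNum i * (D : ℤ) : ℤ) : ℝ)) / ((4 * sDen * sDen : ℤ) : ℝ) = ((sNum i : ℝ) / sDen) ^ 2 * D / 4 := by
        push_cast; field_simp
      rw [e]
      have h1 : ((sNum i : ℝ) / sDen) ^ 2 ≤ s ^ 2 := pow_le_pow_left₀ (by positivity) hs1 2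
      have h2 := mul_le_mul_of_nonneg_right h1 hD'.le
      linarith [div_le_div_of_nonneg_right h2 (by norm_num : (0 : ℝ) ≤ 4)]
    · have e : (((sNum (i + 1) * sNum (i + 1) * (D : ℤ) : ℤ) : ℝ)) / ((4 * sDen * sDen : ℤ) : ℝ) =
          ((sNum (i + 1) : ℝ) / sDen) ^ 2 * D / 4 := by
        push_cast; field_simp
      rw [e]
      have h1 : s ^ 2 ≤ ((sNum (i + 1) : ℝ) / sDen) ^ 2 := pow_le_pow_left₀ hs0.le hs2 2
      have h2 := mul_le_mul_of_nonneg_right h1 hD'.le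
      linarith [div_le_div_of_nonneg_right h2 (by norm_num : (0 : ℝ) ≤ 4)]
  intro h
  induction h with
  | nil => intro _ acc; simp
  | cons Dm rest ih =>
    intro hpos acc
    obtain ⟨D, m⟩ := Dm
    have hrest : ∀ Dm ∈ rest, 0 < Dm.1 := fun Dm hDm => hpos Dm (List.mem_cons_of_mem _ hDm)
    have hDpos : 0 < D := hpos (D, m) List.mem_cons_self
    rw [List.foldl_cons, List.map_cons, List.sum_cons]
    refine (ih hrest _).trans ?_
    by_cases hP : sNum (i + 1) * sNum (i + 1) * (D : ℤ) < 100 * (4 * sDen * sDen)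
    · simp only [hP, ↓reduceIte]
      have := hg D hDpos
      have hm : (0 : ℝ) ≤ m := by exact_mod_cast Nat.zero_le m
      push_cast
      nlinarith
    · simp only [hP, ↓reduceIte]
      simp

/-- class X: every shell of `H0` has `D ≥ 1`. -/
private theorem H0_pos : ∀ Dm ∈ H0, 0 < Dm.1 := by decide +kernel

/-- class Y: every shell of `H1` has `D ≥ 1`. -/
private theorem H1_pos : ∀ Dm ∈ H1, 0 < Dm.1 := by decide +kernel

/-- ★ on `H0`, census's `shellSum i H0 0` IS the fold above on every leaf `i < 128` (closed kernel evaluation). -/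
theorem shellSum_H0_eq : ∀ i ∈ List.range 128, shellSum i H0 0 =
    H0.foldl (fun (acc : ℤ) (Dm : ℕ × ℕ) =>
      if sNum (i + 1) * sNum (i + 1) * (Dm.1 : ℤ) < 100 * (4 * sDen * sDen) then
        acc + (Dm.2 : ℤ) * phiMinLo (sNum i * sNum i * (Dm.1 : ℤ)) (sNum (i + 1) * sNum (i + 1) * (Dm.1 : ℤ)) (4 * sDen * sDen)
      else acc) 0 := by
  decide +kernel

/-- ★ on `H1`, census's `shellSum i H1 0` IS the fold above on every leaf `i < 128` (closed kernel evaluation). -/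
theorem shellSum_H1_eq : ∀ i ∈ List.range 128, shellSum i H1 0 =
    H1.foldl (fun (acc : ℤ) (Dm : ℕ × ℕ) =>
      if sNum (i + 1) * sNum (i + 1) * (Dm.1 : ℤ) < 100 * (4 * sDen * sDen) then
        acc + (Dm.2 : ℤ) * phiMinLo (sNum i * sNum i * (Dm.1 : ℤ)) (sNum (i + 1) * sNum (i + 1) * (Dm.1 : ℤ)) (4 * sDen * sDen)
      else acc) 0 := by
  decide +kernel

/-! ## §3 The transfer leaf test read over `ℝ`, and (s5) -/

/-- the certified `σ` of a class is a lower reading: `sigmaLo h eup i ≤ S·(½W − E − eup/S)` whenever the fold reads `W` and the envelope `E`. -/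
private theorem sigma_reading {sh env eup : ℤ} {W E : ℝ} (hsh : (sh : ℝ) ≤ S * W) (henv : S * E ≤ (env : ℝ)) :
    ((Int.fdiv sh 2 - env - eup : ℤ) : ℝ) ≤ S * (W / 2 - E - (eup : ℝ) / S) := by
  have hS' : (0 : ℝ) < S := by exact_mod_cast S_pos
  have h2 : ((Int.fdiv sh 2 : ℤ) : ℝ) ≤ S * (W / 2) := fdiv_nat_le (by norm_num) hsh
  have e : (S : ℝ) * (W / 2 - E - (eup : ℝ) / S) = S * (W / 2) - S * E - eup := by field_simp
  rw [e]; push_cast; linarith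

/-- ★ THE TRANSFER RULE over `ℝ`: if `12·BAR ≤ 12·sy − 4·(BAR − sx)⁺` in `ℤ` (census's `leafOK`), and `sx, sy` are lower readings of
`S·σ_X, S·σ_Y`, then some transfer `t ≥ 0` gives `σ_X + 12·t ≥ 27/1000` and `σ_Y − 4·t ≥ 27/1000`. -/
theorem transfer_sound {sx sy : ℤ} {σX σY : ℝ} (hx : (sx : ℝ) ≤ S * σX) (hy : (sy : ℝ) ≤ S * σY)
    (hok : 12 * -Int.fdiv (-(27 * S)) 1000 ≤ 12 * sy - 4 * (if sx < -Int.fdiv (-(27 * S)) 1000 then -Int.fdiv (-(27 * S)) 1000 - sx else 0)) :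
    ∃ t : ℝ, 0 ≤ t ∧ 27 / 1000 ≤ σX + 12 * t ∧ 27 / 1000 ≤ σY - 4 * t := by
  have hS' : (0 : ℝ) < S := by exact_mod_cast S_pos
  have hbar := bar_ge S
  set B : ℤ := -Int.fdiv (-(27 * S)) 1000 with hB
  have hok' : ((12 * B : ℤ) : ℝ) ≤ ((12 * sy - 4 * (if sx < B then B - sx else 0) : ℤ) : ℝ) := by exact_mod_cast hok
  by_cases hlt : sx < B
  · rw [if_pos hlt] at hok'
    push_cast at hok'
    refine ⟨((B : ℝ) - sx) / (12 * S), by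
      have : (sx : ℝ) < B := by exact_mod_cast hlt
      positivity, ?_, ?_⟩
    · -- X receives 12 t = (B − sx)/S
      have e : σX + 12 * (((B : ℝ) - sx) / (12 * S)) = (S * σX + (B - sx)) / S := by field_simp
      rw [e, le_div_iff₀ hS']
      linarith
    · -- Y pays 4 t
      have e : σY - 4 * (((B : ℝ) - sx) / (12 * S)) = (12 * (S * σY) - 4 * (B - sx)) / (12 * S) := by field_simp
      rw [e, le_div_iff₀ (by positivity)]
      nlinarith
  · rw [if_neg hlt] at hok'
    push_cast at hok'
    have hge : (B : ℝ) ≤ sx := by exact_mod_cast (not_lt.mp hlt)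
    refine ⟨0, le_rfl, ?_, ?_⟩
    · have : S * (27 / 1000 : ℝ) ≤ S * σX := by linarith
      simpa using le_of_mul_le_mul_left this hS'
    · have : S * (27 / 1000 : ℝ) ≤ S * σY := by linarith
      simpa using le_of_mul_le_mul_left this hS'

/-- (s5) the E_UP numeral dominates the periodic infimum: `e⋆ ≤ EUPc/S` (tree `eStar_le : e⋆ ≤ −0.7175`). -/
private theorem eStar_le_EUPc : eStar ≤ ((EUPc : ℤ) : ℝ) / S := by
  refine FrustratedLawDichotomyPeriodicEnergyCeilingKernel.eStar_le.trans ?_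
  rw [S_cast]; unfold EUPc; norm_num

/-- all 128 leaves pass census's transfer test (`leavesW_0`, `leavesW_1` unpacked leaf by leaf). -/
private theorem leafOK_of_lt {i : ℕ} (hi : i < 128) : leafOK H0 H1 EUPc i = true := by
  by_cases h64 : i < 64
  · have hall : ∀ k ∈ List.range (64 - 0), leafOK H0 H1 EUPc (0 + k) = true := List.all_eq_true.mp leavesW_0
    have hk := hall i (List.mem_range.mpr (by omega))
    rwa [zero_add] at hk
  · have hall : ∀ k ∈ List.range (128 - 64), leafOK H0 H1 EUPc (64 + k) = true := List.all_eq_true.mp leavesW_1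
    have hk := hall (i - 64) (List.mem_range.mpr (by omega))
    rwa [show 64 + (i - 64) = i by omega] at hk

/-- ★★ **DROWS-SOUND, A15 chunk, modulo (s1) and the window/tail assembly.**  For every leaf `i < 128` and every scale
`s ∈ [sNum i/sDen, sNum (i+1)/sDen]` there is a transfer `t ≥ 0` such that
`e⋆ + 27/1000 ≤ ½·Σ_{(D,m) ∈ H0, inside_i D} m·φ(s²D/4) − (1/12)·Env₆(δ_i, R_i) + 12·t`   (class X, receivers) and
`e⋆ + 27/1000 ≤ ½·Σ_{(D,m) ∈ H1, inside_i D} m·φ(s²D/4) − (1/12)·Env₆(δ_i, R_i) − 4·t`   (class Y, payers),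
`δ_i = sNum i/sDen`, `R_i = 10·sNum i/sNum (i+1)`. -/
theorem drows_A15_sound {i : ℕ} (hi : i < 128) {s : ℝ} (hs1 : (sNum i : ℝ) / sDen ≤ s) (hs2 : s ≤ (sNum (i + 1) : ℝ) / sDen)
    {δ R : ℝ} (hδ : δ = (sNum i : ℝ) / sDen) (hR : R = 10 * (sNum i : ℝ) / sNum (i + 1)) :
    ∃ t : ℝ, 0 ≤ t ∧
      eStar + 27 / 1000 ≤ (H0.map fun Dm : ℕ × ℕ =>
          if sNum (i + 1) * sNum (i + 1) * (Dm.1 : ℤ) < 100 * (4 * sDen * sDen) then (Dm.2 : ℝ) * phiT (s ^ 2 * Dm.1 / 4) else 0).sum / 2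
        - 1 / 12 * ((2 / δ) ^ 3 * R⁻¹ ^ 3 + 15 / 2 * (2 / δ) ^ 2 * R⁻¹ ^ 4 + 3 / 5 * (2 / δ) * R⁻¹ ^ 5 + 2 * R⁻¹ ^ 6) + 12 * t ∧
      eStar + 27 / 1000 ≤ (H1.map fun Dm : ℕ × ℕ =>
          if sNum (i + 1) * sNum (i + 1) * (Dm.1 : ℤ) < 100 * (4 * sDen * sDen) then (Dm.2 : ℝ) * phiT (s ^ 2 * Dm.1 / 4) else 0).sum / 2
        - 1 / 12 * ((2 / δ) ^ 3 * R⁻¹ ^ 3 + 15 / 2 * (2 / δ) ^ 2 * R⁻¹ ^ 4 + 3 / 5 * (2 / δ) * R⁻¹ ^ 5 + 2 * R⁻¹ ^ 6) - 4 * t := by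
  have hX := foldZ_le i hs1 hs2 H0 H0_pos 0
  rw [← shellSum_H0_eq i (List.mem_range.mpr hi)] at hX
  have hY := foldZ_le i hs1 hs2 H1 H1_pos 0
  rw [← shellSum_H1_eq i (List.mem_range.mpr hi)] at hY
  simp only [Int.cast_zero, zero_add] at hX hY
  have henv := envHi_sound i hδ hR
  have hsx := sigma_reading (eup := EUPc) hX henv
  have hsy := sigma_reading (eup := EUPc) hY henv
  have hok := leafOK_of_lt hi
  unfold leafOK sigmaLo BAR fdiv cdiv at hok
  simp only [decide_eq_true_eq] at hok
  obtain ⟨t, ht0, htX, htY⟩ := transfer_sound hsx hsy hok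
  have h5 := eStar_le_EUPc
  exact ⟨t, ht0, by linarith, by linarith⟩

end Summit.AtomisticToContinuum.Crystallization.Theorems.FrustratedLawDichotomyDRowsA15Sound
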